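import Summits.BirchSwinnertonDyer.BirchSwinnertonDyer.Theorems.AdditiveKolyvaginRoadKolyvaginCupNonvanishing
import Summits.BirchSwinnertonDyer.BirchSwinnertonDyer.Theorems.AdditiveKolyvaginRoadLocalDictionaries
import Literature.NumberTheory.EllipticCurves.LocalKummerIsotropyTransport
import Literature.NumberTheory.EllipticCurves.KummerImageIsotropyProofs
import Literature.NumberTheory.GaloisCohomology.PoitouTateSumTotallyComplex
import HarnessLib

/-!
# Route `AdditiveKolyvaginRoad`, crux KS′ `LevelKolyvaginSystemsAdditive` (item stmt-BirchSwinnertonDyer-21396) ∕ KPA′ (21400):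
# THE VISIBILITY STEP — a same-sign partner detected at a Kolyvagin prime makes a ramified eigenclass NON-ZERO at a prescribed place
# (cell `pub/bsd-wall`, width seat `bsd-wall-akr-p2x-w3` g9; `--supports stmt-BirchSwinnertonDyer-21396`, helper; E-side engine lemma for the
# crux-ideate card `Cruxes/LevelKolyvaginSystemsAdditive/Ideas/visible-vertex-transfer.md`, lever (V); part 1 of 2, sequel
# `…KolyvaginVisibilityAtP.lean`)

WHY. The card `visible-vertex-transfer` (crux-ideate r1 seat 2, 2026-08-28) transfers W. Zhang's mod-`p` Kolyvagin non-vanishing from a `p`-GOOD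
avatar `E₀` to the `p`-ADDITIVE congruent curve `E` through a DERIVED Kriz–Li congruence at a Kolyvagin conductor `n` (its unprinted input DKL_n);
the congruence reads a unit only if the avatar's class is `𝔭`-VISIBLE, i.e. has NON-ZERO localisation at a place above `p`.  Its lever (V) — «one
Čebotarev step makes a non-zero Kolyvagin class visible» — rests on ONE Poitou–Tate sum.  THIS FILE isolates that sum as a reusable step, in the
tree's currency (`selmerLocalKer` ∕ `torsionLocalKer` ∕ `conjAct` eigen-signs), with every local hypothesis displayed; the sequel runs the steps.

WHAT (namespace `…Theorems.AdditiveKoly`; level written `p ^ 1` as in the carrier `Vp W K p`).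
* §1 `exists_cupProduct_ne_zero_of_ne` — Tate reciprocity bookkeeping for ANY elliptic curve over a totally complex number field `K` (PROVED
  reciprocity `poitouTate_sum_localTatePairing_eq_zero_of_isTotallyComplex`, no named fact): if the local Weil cup products of two global
  classes vanish off a finite set `S` of places and the one at a finite `v₀ ∈ S` does NOT vanish, then the one at some `w ∈ S`, `w ≠ v₀`, does not.
* §2 `not_mem_torsionLocalKer_of_visiblePartner` — THE VISIBILITY STEP (frame: `K` imaginary quadratic, `p` odd, `ρ̄_{E,p}` onto, `c ≠ 1`, any
  reduction type at `p`): `y`, `r` eigenclasses of the SAME sign; `y` Kummer at `∞` and at the finite places off `λ ∪ Z`, NOT Kummer at the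
  Kolyvagin place `λ`; `r` Kummer at `∞` and off `Σ ∌ λ`, detected at `λ`, silent on `Z` — then at some place of `Σ` both `y` and `r` are
  detected (`cupProduct_ne_zero_of_selmer_of_not_selmer_P` at `λ` + Kummer isotropy `kummerClass_cupProduct_kummerClass_eq_zero_holds` + §1).

HONEST FRAMING: theorems only; 0 definitions, 0 named facts, 0 `sorry`; every hypothesis is a displayed binder; closes nothing.  BSD is not proved
by any of this; KS′ ∕ KPA′ stay OPEN at `p² ∣ N`.

References: [cite: GrossLMS1991, Prop. 8.1, Prop. 8.2, §9] [cite: McCallumLMS1991, Lemma 5.3] [cite: WZhang2014, Lemma 8.2, Lemma 8.4]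
[cite: MilneADT2006, Ch. I, Thm. 4.10] [cite: CasselsFrohlichANT1967, Ch. VII §11].
-/

set_option linter.dupNamespace false -- single-conjunct summit repeats the name by design

noncomputable section

open scoped Classical

namespace Summit.BirchSwinnertonDyer.BirchSwinnertonDyer.Theorems.AdditiveKoly

open CategoryTheory WeierstrassCurve Field Function NumberField IsDedekindDomain
open Literature.NumberTheory.EllipticCurves Literature.NumberTheory.EllipticCurves.ModularForms
  Literature.NumberTheory.GaloisRepresentations Module
open Literature.NumberTheory.GaloisCohomology
open Summit.BirchSwinnertonDyer.Rank1Residual.X11b.Three.Koly.Method2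
open scoped ContRepresentation

/-! ## §1 Tate reciprocity bookkeeping: a non-zero local term forces a second one -/

section Reciprocity

variable {K : Type} [Field K] [NumberField K] [IsTotallyComplex K] (W : WeierstrassCurve K) (p : ℕ)
  [Fact p.Prime] [W.IsElliptic] [∀ v : Place K, CompactSpace (absoluteGaloisGroup (Place.Completion v))]
variable (e : geomTorsion W p → geomTorsion W p → AlgebraicClosure K)
  (hμ : ∀ S T, e S T ^ p = 1)
  (hadd₁ : ∀ S₁ S₂ T, e (S₁ + S₂) T = e S₁ T * e S₂ T)
  (hadd₂ : ∀ S T₁ T₂, e S (T₁ + T₂) = e S T₁ * e S T₂)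
  (hgal : ∀ (σ : absoluteGaloisGroup K) (S T : geomTorsion W p), σ • e S T = e (σ • S) (σ • T))

include hμ hadd₁ hadd₂ hgal in
/-- **A non-zero local Weil term at a finite place forces a second one** (Tate's reciprocity law for the totally complex `K`, PROVED in the
tree as `poitouTate_sum_localTatePairing_eq_zero_of_isTotallyComplex`): if for two global classes `y, z ∈ H¹(K, E[p])` the local Weil cup
products `loc_w y ∪ₑ loc_w z` vanish at every place `w ∉ S` and the one at the finite place `v₀ ∈ S` does NOT vanish, then the one at some
`w ∈ S`, `w ≠ v₀`, does not vanish either (`∑_{w ∈ S} inv_w(loc_w y ∪ₑ loc_w z) = 0` and `inv_{v₀}` is injective).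
[cite: MilneADT2006, Ch. I, Thm. 4.10(b)] [cite: CasselsFrohlichANT1967, Ch. VII §11] -/
theorem exists_cupProduct_ne_zero_of_ne (S : Finset (Place K)) {v₀ : HeightOneSpectrum (𝓞 K)}
    (hv₀ : (Sum.inr v₀ : Place K) ∈ S) {y z : galH1Torsion W (p : ℤ)}
    (hS : ∀ w : Place K, w ∉ S →
      (weilContPairingLocal W p e hμ hadd₁ hadd₂ hgal w).cupProduct
        (galoisCohomology.localization (W.torsionGaloisModule p) w 1 y)
        (galoisCohomology.localization (W.torsionGaloisModule p) w 1 z) = 0)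
    (h₀ : (weilContPairingLocal W p e hμ hadd₁ hadd₂ hgal (Sum.inr v₀)).cupProduct
        (galoisCohomology.localization (W.torsionGaloisModule p) (Sum.inr v₀) 1 y)
        (galoisCohomology.localization (W.torsionGaloisModule p) (Sum.inr v₀) 1 z) ≠ 0) :
    ∃ w ∈ S, w ≠ Sum.inr v₀ ∧
      (weilContPairingLocal W p e hμ hadd₁ hadd₂ hgal w).cupProduct
        (galoisCohomology.localization (W.torsionGaloisModule p) w 1 y)
        (galoisCohomology.localization (W.torsionGaloisModule p) w 1 z) ≠ 0 := by
  have hp : p.Prime := Fact.out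
  haveI : NeZero p := ⟨hp.ne_zero⟩
  obtain ⟨inv, hperf, hPT⟩ := poitouTate_sum_localTatePairing_eq_zero_of_isTotallyComplex K p
  have h := sum_inv_weilCupProduct_localization_eq_zero W p e hμ hadd₁ hadd₂ hgal inv hPT y z S (fun w hw => by
    rw [hS w hw]
    exact map_zero (inv w))
  rw [← Finset.add_sum_erase S _ hv₀] at h
  have hinj : Function.Injective (inv (Sum.inr v₀)) := (hperf v₀).1.1
  have h₀' : inv (Sum.inr v₀) ((weilContPairingLocal W p e hμ hadd₁ hadd₂ hgal (Sum.inr v₀)).cupProduct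
        (galoisCohomology.localization (W.torsionGaloisModule p) (Sum.inr v₀) 1 y)
        (galoisCohomology.localization (W.torsionGaloisModule p) (Sum.inr v₀) 1 z)) ≠ 0 := fun h0 ↦
    h₀ (hinj (h0.trans (map_zero _).symm))
  have hrest : ∑ w ∈ S.erase (Sum.inr v₀), inv w ((weilContPairingLocal W p e hμ hadd₁ hadd₂ hgal w).cupProduct
        (galoisCohomology.localization (W.torsionGaloisModule p) w 1 y)
        (galoisCohomology.localization (W.torsionGaloisModule p) w 1 z)) ≠ 0 := by
    intro h0
    rw [h0, add_zero] at h
    exact h₀' h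
  obtain ⟨w, hw, hw0⟩ := Finset.exists_ne_zero_of_sum_ne_zero hrest
  refine ⟨w, Finset.mem_of_mem_erase hw, Finset.ne_of_mem_erase hw, fun h0 ↦ hw0 ?_⟩
  rw [h0]
  exact map_zero (inv w)

end Reciprocity

/-! ## §2 The visibility step: a same-sign partner, Kummer off `Σ`, detected at `λ` and silent on `Z`, makes `y` visible on `Σ` -/

section Step

variable (W : WeierstrassCurve ℚ) (K : Type) [Field K] [NumberField K] (p : ℕ) [W.IsElliptic] [W.IsGloballyMinimal]
  [Fact p.Prime] (c : K ≃ₐ[ℚ] K)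

/-- **THE VISIBILITY STEP.** Frame: `K` imaginary quadratic, `p` odd, `ρ̄_{E,p}` onto, `c ≠ 1` (any reduction type of `E` at `p`); `ℓ` a
Zhang–Kolyvagin prime with place `λ`; `Σ ∌ λ` and `Z` finite sets of finite places.  Let `y, r ∈ H¹(K, E[p])` be eigenclasses of complex
conjugation of the SAME sign `s` with: `y` Kummer at the infinite places and at every finite place off `λ ∪ Z`, and NOT Kummer at `λ`; `r`
Kummer at the infinite places and at every finite place off `Σ`, with localisation ZERO at the places of `Z` and NON-ZERO at `λ`.  Then at some
place `w ∈ Σ` BOTH `y` and `r` have non-zero localisation.  Proof: the local Weil terms `loc_w r ∪ₑ loc_w y` vanish off `{λ} ∪ Σ` (Kummer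
isotropy `kummerClass_cupProduct_kummerClass_eq_zero_holds`, or `loc_w r = 0` on `Z`), the one at `λ` is non-zero (unramified × ramified of
the same sign, `cupProduct_ne_zero_of_selmer_of_not_selmer_P` — Gross Prop. 8.1 ∕ 9.6), so by Tate reciprocity (§1) some term on `Σ` is
non-zero, whence both localisations there are. [cite: GrossLMS1991, Prop. 8.1, Prop. 8.2] [cite: McCallumLMS1991, Lemma 5.3]
[cite: WZhang2014, Lemma 8.4] [cite: MilneADT2006, Ch. I, Thm. 4.10] -/
theorem not_mem_torsionLocalKer_of_visiblePartner (hK : IsImaginaryQuadratic K) (hp2 : p ≠ 2)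
    (hsurj : W.HasSurjectiveModNGaloisRep p) (hc : c ≠ 1)
    {ℓ : ℕ} (hℓ : Zhang2014.IsKolyvaginPrime (W.conductorNorm ℤ) W K p ℓ) (lam : HeightOneSpectrum (𝓞 K))
    (hlam : (ℓ : 𝓞 K) ∈ lam.asIdeal) (Sig Z : Finset (HeightOneSpectrum (𝓞 K))) (hSig : lam ∉ Sig) (s : Bool) {y r : Vp W K p}
    (hys : conjAct W c ((p ^ 1 : ℕ) : ℤ) y = sgnP s • y) (hrs : conjAct W c ((p ^ 1 : ℕ) : ℤ) r = sgnP s • r)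
    (hyinf : ∀ w : InfinitePlace K, y ∈ selmerLocalKer (W.baseChange K) w.Completion ((p ^ 1 : ℕ) : ℤ))
    (hyfin : ∀ v : HeightOneSpectrum (𝓞 K), v ≠ lam → v ∉ Z →
      y ∈ selmerLocalKer (W.baseChange K) (v.adicCompletion K) ((p ^ 1 : ℕ) : ℤ))
    (hylam : y ∉ selmerLocalKer (W.baseChange K) (lam.adicCompletion K) ((p ^ 1 : ℕ) : ℤ))
    (hrinf : ∀ w : InfinitePlace K, r ∈ selmerLocalKer (W.baseChange K) w.Completion ((p ^ 1 : ℕ) : ℤ))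
    (hrfin : ∀ v : HeightOneSpectrum (𝓞 K), v ∉ Sig →
      r ∈ selmerLocalKer (W.baseChange K) (v.adicCompletion K) ((p ^ 1 : ℕ) : ℤ))
    (hrZ : ∀ v ∈ Z, r ∈ (W.baseChange K).torsionLocalKer (v.adicCompletion K) ((p ^ 1 : ℕ) : ℤ))
    (hrlam : r ∉ (W.baseChange K).torsionLocalKer (lam.adicCompletion K) ((p ^ 1 : ℕ) : ℤ)) :
    ∃ w ∈ Sig, y ∉ (W.baseChange K).torsionLocalKer (w.adicCompletion K) ((p ^ 1 : ℕ) : ℤ) ∧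
      r ∉ (W.baseChange K).torsionLocalKer (w.adicCompletion K) ((p ^ 1 : ℕ) : ℤ) := by
  have hp : p.Prime := Fact.out
  haveI : Fact (Nat.Prime (p ^ 1)) := ⟨by rw [pow_one]; exact hp⟩
  haveI : NeZero (p ^ 1 : ℕ) := ⟨pow_ne_zero 1 hp.ne_zero⟩
  haveI : IsTotallyComplex K := hK.2
  haveI : ∀ w : Place K, CompactSpace (absoluteGaloisGroup (Place.Completion w)) := fun w ↦
    absoluteGaloisGroup_compactSpace _
  haveI : Finite (geomTorsion (W.baseChange K) ((p ^ 1 : ℕ) : ℤ)) :=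
    finite_geomTorsion_of_neZero (W.baseChange K) (p ^ 1)
  have hpZ : ((p ^ 1 : ℕ) : ℤ) ≠ 0 := by exact_mod_cast pow_ne_zero 1 hp.ne_zero
  -- a Weil pairing on `E[p]`
  obtain ⟨e, hμ, hadd₁, hadd₂, halt, hnondeg, hgal⟩ :=
    exists_weilPairing_holds (W.baseChange K) (p ^ 1) (by rw [pow_one]; exact hp.two_le) (by
      rw [pow_one]; exact_mod_cast hp.ne_zero)
  -- Kummer isotropy at a place where both classes satisfy the Kummer condition
  have hKum : ∀ w : Place K,
      r ∈ selmerLocalKer (W.baseChange K) (Place.Completion w) ((p ^ 1 : ℕ) : ℤ) →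
      y ∈ selmerLocalKer (W.baseChange K) (Place.Completion w) ((p ^ 1 : ℕ) : ℤ) →
      (weilContPairingLocal (W.baseChange K) (p ^ 1) e hμ hadd₁ hadd₂ hgal w).cupProduct
        (galoisCohomology.localization ((W.baseChange K).torsionGaloisModule ((p ^ 1 : ℕ) : ℤ)) w 1 r)
        (galoisCohomology.localization ((W.baseChange K).torsionGaloisModule ((p ^ 1 : ℕ) : ℤ)) w 1 y) = 0 := by
    intro w hrw hyw
    rw [← comap_localization_kummerSelmerStructure] at hrw hyw
    exact (W.baseChange K).cupProduct_eq_zero_of_mem_kummerSelmerStructure_of_fact (p ^ 1) e hpZ w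
      (kummerClass_cupProduct_kummerClass_eq_zero_holds _) hμ hadd₁ hadd₂ halt hgal hrw hyw
  -- the exceptional set `S = {λ} ∪ Σ`
  set S : Finset (Place K) := insert (Sum.inr lam) (Sig.image Sum.inr) with hSdef
  have hS : ∀ w : Place K, w ∉ S →
      (weilContPairingLocal (W.baseChange K) (p ^ 1) e hμ hadd₁ hadd₂ hgal w).cupProduct
        (galoisCohomology.localization ((W.baseChange K).torsionGaloisModule ((p ^ 1 : ℕ) : ℤ)) w 1 r)
        (galoisCohomology.localization ((W.baseChange K).torsionGaloisModule ((p ^ 1 : ℕ) : ℤ)) w 1 y) = 0 := by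
    intro w hw
    rcases w with w | v
    · exact hKum (Sum.inl w) (hrinf w) (hyinf w)
    · have hvlam : v ≠ lam := fun h ↦ hw (by rw [hSdef, h]; exact Finset.mem_insert_self _ _)
      have hvSig : v ∉ Sig := fun h ↦ hw (by
        rw [hSdef]; exact Finset.mem_insert_of_mem (Finset.mem_image_of_mem _ h))
      by_cases hvZ : v ∈ Z
      · have h0 : galoisCohomology.localization ((W.baseChange K).torsionGaloisModule ((p ^ 1 : ℕ) : ℤ)) (Sum.inr v) 1 r = 0 :=
          (mem_torsionLocalKer_iff_localization_eq_zero_P W K p v r).mp (hrZ v hvZ)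
        rw [h0]
        exact (DFunLike.congr_fun (map_zero (weilContPairingLocal (W.baseChange K) (p ^ 1) e hμ hadd₁ hadd₂ hgal
          (Sum.inr v)).cupProduct) _).trans (LinearMap.zero_apply _)
      · exact hKum (Sum.inr v) (hrfin v hvSig) (hyfin v hvlam hvZ)
  -- the term at `λ` does not vanish: unramified (`r`) × ramified (`y`) of the same sign
  have h₀ := cupProduct_ne_zero_of_selmer_of_not_selmer_P W K p hK hp2 hsurj hc e hμ hadd₁ hadd₂ halt hnondeg hgal hℓ lam hlam s
    hrs hys (hrfin lam hSig) hrlam hylam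
  -- Tate reciprocity: a second non-zero term, necessarily on `Σ`
  obtain ⟨w, hwS, hwne, hw0⟩ := exists_cupProduct_ne_zero_of_ne (W.baseChange K) (p ^ 1) e hμ hadd₁ hadd₂ hgal S
    (by rw [hSdef]; exact Finset.mem_insert_self _ _) hS h₀
  rw [hSdef, Finset.mem_insert] at hwS
  rcases hwS with hwS | hwS
  · exact absurd hwS hwne
  obtain ⟨v, hv, rfl⟩ := Finset.mem_image.mp hwS
  refine ⟨v, hv, fun hy0 ↦ hw0 ?_, fun hr0 ↦ hw0 ?_⟩
  · rw [(mem_torsionLocalKer_iff_localization_eq_zero_P W K p v y).mp hy0]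
    exact map_zero _
  · rw [(mem_torsionLocalKer_iff_localization_eq_zero_P W K p v r).mp hr0]
    exact (DFunLike.congr_fun (map_zero (weilContPairingLocal (W.baseChange K) (p ^ 1) e hμ hadd₁ hadd₂ hgal
      (Sum.inr v)).cupProduct) _).trans (LinearMap.zero_apply _)

end Step

end Summit.BirchSwinnertonDyer.BirchSwinnertonDyer.Theorems.AdditiveKoly

end
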